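import Summits.ValiantsHypothesis.ValiantsHypothesis.Theorems.GrenetZeonDualUnipotentThreeHalvesHeavyTopTowerLemmas
import Summits.ValiantsHypothesis.ValiantsHypothesis.Theorems.GrenetZeonDualUnipotentThreeHalvesHeavyTopTowerDimension

/-!
# `GrenetZeon.DualUnipotentThreeHalves` (stmt-ValiantsHypothesis-24318), R2 heavy-top instrument — COROLLARY II, SHARPNESS of the tower branch:
# a space in tower form IS a non-triangularisable nilpotent space of dimension `C(m,2) − 1`

Companion of ★ `…HeavyTopCodimOneClassification.codimOne_classification` (the converse direction of its second disjunct): if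
`A ∈ V ↔ reindex e e (P A P⁻¹) ∈ towerHull p q I` for a unit `P`, a re-indexing `e : Fin m ≃ Fin (p+3+q)` and a nilpotent plane `I ≤ M₃(ℂ)`, then
`V` consists of nilpotent matrices, `dim V = C(m,2) − 1`, and — when `I` is irreducible — the image `{reindex e e (P A P⁻¹) : A ∈ V}` (the whole tower)
is conjugate into `𝔫` by NO unit: the tower branch of COROLLARY II is genuinely non-triangularisable, so the two branches describe different spaces
(✓ `isNilpotent_of_mem_towerHull`, ✓ `finrank_towerHull_of_finrank_eq_two`, ✓ `not_strictUpper_conj_towerHull`).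

* ★ `tower_form_sharp` — the three facts.

Honest framing: linear algebra; nothing here proves or refutes `HeavyTopLaw`, 24318, S3b or 8062; `VP ≠ VNP` is NOT proved.  No definitions.
[val-idea-30 MEMO codim-one §4 (ii)–(iii); cell val-heavytop-census, eng-1 g5]
-/

noncomputable section

-- single-conjunct layout: Sub = Summit, duplicated namespace component intended
set_option linter.dupNamespace false

namespace Summit.ValiantsHypothesis.ValiantsHypothesis.Theorems.GrenetZeon.HeavyTopCodimOneSharp

open Matrix
open Summit.ValiantsHypothesis.ValiantsHypothesis.Theorems.GrenetZeon.HeavyTopTowerDefs (towerHull)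
open Summit.ValiantsHypothesis.ValiantsHypothesis.Theorems.GrenetZeon.HeavyTopTowerLemmas (isNilpotent_of_mem_towerHull not_strictUpper_conj_towerHull)
open Summit.ValiantsHypothesis.ValiantsHypothesis.Theorems.GrenetZeon.HeavyTopTowerDimension (finrank_towerHull_of_finrank_eq_two)
open Literature.LinearAlgebra.Matrix.GerstenhaberNilpotentSubspace (conjEquiv isNilpotent_conjEquiv_iff)
open Literature.LinearAlgebra.Matrix (IsStrictUpper)

/-- ★ **Sharpness of the tower branch.**  A space in tower form is nilpotent, has dimension `C(m,2) − 1`, and its tower image is not conjugate into `𝔫`.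
[val-idea-30 MEMO codim-one §4 (ii)–(iii)] -/
theorem tower_form_sharp {m p q : ℕ} (e : Fin m ≃ Fin (p + 3 + q)) (I : Submodule ℂ (Matrix (Fin 3) (Fin 3) ℂ))
    (hI : ∀ X ∈ I, IsNilpotent X) (hI2 : Module.finrank ℂ I = 2)
    (P : Matrix (Fin m) (Fin m) ℂ) (hP : IsUnit P) (V : Submodule ℂ (Matrix (Fin m) (Fin m) ℂ))
    (hV : ∀ A, A ∈ V ↔ Matrix.reindex e e (P * A * P⁻¹) ∈ towerHull p q I) :
    (∀ A ∈ V, IsNilpotent A) ∧ Module.finrank ℂ V = m.choose 2 - 1 ∧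
      ((∀ U : Submodule ℂ (Fin 3 → ℂ), (∀ X ∈ I, ∀ x ∈ U, X *ᵥ x ∈ U) → U = ⊥ ∨ U = ⊤) →
        ¬ ∃ R : Matrix (Fin (p + 3 + q)) (Fin (p + 3 + q)) ℂ, IsUnit R ∧
          ∀ A ∈ V, IsStrictUpper (R * Matrix.reindex e e (P * A * P⁻¹) * R⁻¹)) := by
  classical
  have hPdet : IsUnit P.det := (Matrix.isUnit_iff_isUnit_det P).1 hP
  -- the linear equivalence `A ↦ reindex e e (P A P⁻¹)`
  let φ : Matrix (Fin m) (Fin m) ℂ ≃ₗ[ℂ] Matrix (Fin (p + 3 + q)) (Fin (p + 3 + q)) ℂ :=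
    (conjEquiv P hPdet).trans (Matrix.reindexLinearEquiv ℂ ℂ e e)
  have hφ : ∀ A, φ A = Matrix.reindex e e (P * A * P⁻¹) := fun A => rfl
  have hVc : V = (towerHull p q I).comap (φ : Matrix (Fin m) (Fin m) ℂ →ₗ[ℂ] Matrix (Fin (p + 3 + q)) (Fin (p + 3 + q)) ℂ) := by
    ext A
    rw [Submodule.mem_comap, hV A]
    exact Iff.rfl
  have hm : m = p + 3 + q := by simpa using Fintype.card_congr e
  refine ⟨fun A hA => ?_, ?_, fun hirr => ?_⟩
  · -- nilpotency pulls back along `φ`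
    have hT := isNilpotent_of_mem_towerHull I hI _ ((hV A).1 hA)
    obtain ⟨k, hk⟩ := hT
    have hk' : Matrix.reindexAlgEquiv ℂ ℂ e ((P * A * P⁻¹) ^ k) = 0 := by
      rw [map_pow]; exact hk
    rw [map_eq_zero_iff _ (Matrix.reindexAlgEquiv ℂ ℂ e).injective] at hk'
    exact (isNilpotent_conjEquiv_iff P hPdet A).1 ⟨k, hk'⟩
  · rw [hVc, Submodule.comap_equiv_eq_map_symm, LinearEquiv.finrank_map_eq, finrank_towerHull_of_finrank_eq_two p q I hI2, hm]
  · rintro ⟨R, hR, hsu⟩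
    refine not_strictUpper_conj_towerHull I hirr ⟨R, hR, fun B hB => ?_⟩
    have hBV : φ.symm B ∈ V := by
      rw [hV, ← hφ, LinearEquiv.apply_symm_apply]; exact hB
    have := hsu _ hBV
    rwa [← hφ, LinearEquiv.apply_symm_apply] at this

end Summit.ValiantsHypothesis.ValiantsHypothesis.Theorems.GrenetZeon.HeavyTopCodimOneSharp

end
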